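import Summits.ABC.ABC.Theses.IsogenyGlueCongruence
import Summits.ABC.ABC.Theorems.IsogenyGlueCongruenceDegreePrimesPolyBoundedNewPartFrame
import Summits.ABC.ABC.Theorems.IsogenyGlueCongruenceDegreePrimesPolyBoundedNewPartEquivalence
import Summits.ABC.ABC.Theorems.IsogenyGlueCongruenceDegreePrimesPolyBoundedNewPartProductRegime
import Summits.ABC.ABC.Theorems.IsogenyGlueCongruenceDegreePrimesPolyBoundedStubOldLevelCongruence
import Summits.ABC.ABC.Theorems.IsogenyGlueCongruenceDegreePrimesPolyBoundedStubModularity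
import Summits.ABC.ABC.Theorems.IsogenyGlueCongruenceDegreePrimesPolyBoundedStubMazurKenku
import Summits.ABC.ABC.Theorems.DegreePrimesPolyBounded.Negative.Variants
import Summits.ABC.ABC.Theorems.DegreePrimesPolyBounded.Negative.Pump
import Mathlib.RingTheory.Discriminant
import HarnessLib

/-!
# Crux A `DegreePrimesPolyBounded` (stmt-ABC-2045) — line `newpart-congruence-friability`, skeleton v3

Lead: prover-line-stmt-ABC-2045-c18-0 (re-audit lead c18, 2026-08-17T04Z; v2 = lead c3's reshape at the
bet, sha ad0a2132, stubs unchanged here: `stub_modularity`, `stub_mazurKenku`, `stub_oldLevelCongruence`,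
`stub_newPartPrimesOfDatum`; v1 = planner crux-plan skeleton owned by lead -1, sha 6d1f6e21).

## v3 = v2 + the E-free kernel of the bet QUANTIFIED (c18; stubs and composition byte-identical to v2)

What is open in `stub_newPartPrimesOfDatum` is the passage from the partner's orbit dimension
`d = rank_ℤ 𝕋/P` in the exponent (`log η ≤ 3 d log N`, landed; `ℓ ≤ N^{22 d_f d_g}`, p100949) to an
absolute exponent.  c18 LANDED (`--supports stmt-ABC-2045`) the exact mechanism behind every such soft
bound, as two theorems about the Hecke ring:
* p141809 `…NewPartPluecker` (`heckeCongruenceModulus_dvd_det_augmented`, registered sub-goal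
  `stub_augmentedDeterminantDivisibility`): `η_f(P)` divides `det[b-coords(x_j mod P); χ_f(x_j)]` for ANY
  `d + 1` Hecke operators `x_j` and any `ℤ`-basis `b` of `𝕋/P` (Plücker form of Pasten Prop 5.4: the
  cofactors of the last row are an integer relation of the orbit);
* p142474 `…NewPartDiscriminant` (`heckeCongruenceModulus_sq_mul_discr_le`, sub-goal
  `stub_discriminantCongruenceBound`) and p143335 `…NewPartDiscriminantGram` (sharp Gram form,
  `exists_heckeCongruenceModulus_sq_mul_discr_le_gram`, sub-goal `stub_discriminantCongruenceBoundGram`): `η_f(P)² · |disc_ℤ(𝕋/P)| ≤ ∏_j (∑_ρ |ρ(x_j)|² + χ_f(x_j)²)`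
  over the `d` complex points `ρ` of the orbit, whenever the `x_j` are independent modulo `P ∩ 𝕀_f`
  (orders: `Frac(𝕋/P)` is the localisation at `ℤ ∖ 0`, `|det ρ_i(b_k)|² = |disc|`; block determinant;
  Hadamard).
Hence, with `x = (T_{n_0}=1, T_{n_1}, …, T_{n_d})` the PIVOT operators of the orbit plus one index where `f`
breaks the orbit's relations (two-orbit Sturm, `m ≤ μ(N rad N)/6`), `log η_f(P) ≤ log Θ(P) + O(log N)` with
the E-FREE invariant `Θ(P) := ∏_{j ≤ d} Tr_{(𝕋/P)/ℤ}(T_{n_j}²)^{1/2} / |disc_ℤ(𝕋/P)|^{1/2} ≥ 1`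
(`= [𝕋/P : ℤ⟨T_pivots⟩] ×` orthogonality defect of the pivot Gram matrix).  So the bet — and with it
crux A, modulo the three named facts — follows from
  (DR) `log Θ(P) ≤ κ₀ log N` for every NEW orbit `P` of squarefree level `N`
("pivot discriminant roundness of new Hecke orders"), an E-free statement strictly inside the socket and
measured orbit by orbit by the lead's census (`Cruxes/DegreePrimesPolyBounded/CENSUS-c18-heckeorder.md`,
kit j022769/j022961/j023029: `log Θ`, `rd(𝕋/P)` against `d²`, pivot index, defect, for all orbits of prime
level `N ≤ 1100`).  Linear growth of `log Θ` in `d` there = the discriminant lever is dead (recorded as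
such); `log Θ = O(log N)` = (DR) becomes the line's typed E-free bet with the transfer above.

Crux (route `IsogenyGlueCongruence`, rank 3): every prime factor `ℓ` of the modular degree of a
semistable `E/ℚ` (globally minimal model `W`, conductor `N`, `∃ D` form) is `≤ C · N^κ`.

## v2 = v1 RESHAPED at the bet (why; lead c3)

Everything provable in v1 is LANDED (`--supports stmt-ABC-2045`): the frame p96184
(`degreePrimesPolyBounded_of_newPartPrimesOfDatum`, `stub_frame`, graded ⟹ rational ⟹ datum form,
`discValuation_of_modularity_of_mazurKenku`), Pasten Thm 5.5 p86085, Atkin–Lehner–Li p86417, the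
old-partner peeling p88376, the glue p89252, the semistable-modularity reshape p96773, the Mazur–Kenku
reshape p99803, the old-level congruence modulo two Galois facts p102794, the E-free realization /
separation / PRODUCT regime `ℓ ≤ N^{22 d_f d_g}` p97711 / p99372 / p100949, and the socket
equivalence p106321.  The last one is a theorem ABOUT the line: the datum form `NewPartPrimesOfDatum`
— the only thing the composition consumes from the bet — is EQUIVALENT to the crux modulo the named
facts (`newPartPrimesOfDatum_iff_degreePrimesPolyBounded`; and `≡ KSameLevel`, the same-level piece
of crux K).  Hence v1's registered bet `stub_gradedNewPartFriability` (E-free, graded) is crux A plus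
two gratuitous surpluses (the grading `d_f ≥ 2`; "all rational newforms" instead of curve newforms)
that nothing consumes and that a refuter could kill WITHOUT touching A.  v2 therefore registers as the
bet exactly the socket, `stub_newPartPrimesOfDatum`, keeps the E-free statements
`GradedNewPartFriability ⟹ RationalNewPartFriability ⟹ socket` as PROVED reductions (so either
stronger bet still closes the composition unchanged), and composes by name through the landed frame.
Registered stubs of v2: `stub_modularity` (route item stmt-ABC-15126, verbatim), `stub_mazurKenku`
(route item stmt-ABC-15125, verbatim), `stub_oldLevelCongruence` (verbatim; LANDED modulo Mazur 1978
Thm 4 + Deligne–Serre wt 2 as `stub_oldLevelCongruence_of_galoisFacts`), `stub_newPartPrimesOfDatum`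
(THE BET = the socket ≡ crux A).  `stub_frame` is no longer needed (the landed frame is applied to the
stubs by name) and `stub_gradedNewPartFriability` is retired (strictly stronger than the new bet;
`stub_newPartPrimesOfDatum_of_graded` below).

* `stub_modularity`          — `ModularDatumExists` (Wiles/Taylor–Wiles/BCDT + Edixhoven). KNOWN, XL.
* `stub_mazurKenku`          — `PastenShimura2024_minimalDegree_le_163_mul` (Mazur 1978 + Kenku 1982;
  `IsGloballyMinimal` is load-bearing exactly here, Disproof near-miss). KNOWN, XL.
* `stub_oldLevelCongruence`  — old-level congruence primes `ℓ ≥ 11`, `ℓ ∤ N` divide `v_p(Δ_min)`,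
  `p ∣ N/M` (Ribet 1990 §§1–2). KNOWN; landed modulo `hMazur` (Thm 4) + `hDS` (p102794).
* `stub_newPartPrimesOfDatum` — THE BET (socket): new-partner congruence primes of the datum of a
  semistable curve are `≤ C N^κ`.  OPEN ≡ crux A ≡ `KSameLevel` modulo named facts (p106321).

Composition: `DegreePrimesPolyBounded_of := degreePrimesPolyBounded_of_newPartPrimesOfDatum
(stub_modularity ·) stub_mazurKenku stub_spectral stub_minimalPrimes (stub_oldPartner_of
stub_oldLevelCongruence) (discValuation_of_modularity_of_mazurKenku stub_modularity stub_mazurKenku)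
stub_newPartPrimesOfDatum` — real term, the only `sorry`s in its cone are the four stubs.

Disproof.lean (cdisprove cycle 1, tree 06:40Z 08-16; unchanged, re-read 08-17T01:20Z) honoured as in
v1: `∃ D` instantiated through the class-minimal datum (never `∀ D`: `pump`, `deg_eq_sq_mul_deg`);
minimality consumed at `stub_mazurKenku` (near-miss `degreePrimesPolyBounded_false_without_minimal`);
prime-by-prime, never `η` itself (`withoutPrime_iff_polyDegree`); level-one junk edge excluded by
`stub_modularity` (`Negative.isEmpty_modularParametrizationData_of_eq_one`); no `-- Targets` section.
-/

set_option linter.dupNamespace false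

noncomputable section

open scoped MatrixGroups ModularForm
open CongruenceSubgroup
open Literature.NumberTheory.EllipticCurves.ModularForms
open Summit.ABC.ABC.Theses.IsogenyGlueCongruence
open Summit.ABC.ABC.Theorems.DegreePrimesPolyBounded
open Summit.ABC.ABC.Theorems.IGCTorsionSharing

namespace Summit.ABC.ABC.Cruxes.DegreePrimesPolyBounded.NewpartCongruenceFriability

/-! ## The statements of the line -/

/-- **Graded new-part friability of the Hecke order of a squarefree level** (v1's bet, E-free; now a
documented STRONGER form of the registered bet).  For `N` squarefree and newforms `f, g ∈ S₂(Γ₀(N))`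
with distinct eigen-ideals, every prime dividing `η(f,[g]) = #𝕋_N/(𝕀_f + 𝕀_g)` is
`≤ C · N^{κ · rank_ℤ(𝕋_N/𝕀_f)}`.  Known: exponent `22 · d_f · d_g` (`stub_gradedProductRegime`,
p100949); the grading asks for `d_f` alone. -/
def GradedNewPartFriability : Prop :=
  ∃ κ C : ℝ, ∀ (N : ℕ) [NeZero N], Squarefree N →
    ∀ (f g : CuspForm (Gamma0 N) 2), IsNewform0 f → IsNewform0 g →
      eigenIdeal f ≠ eigenIdeal g →
      ∀ ℓ : ℕ, ℓ.Prime → heckeCongruenceModulus f (eigenIdeal g) ≠ 0 →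
        ℓ ∣ heckeCongruenceModulus f (eigenIdeal g) →
        (ℓ : ℝ) ≤ C * (N : ℝ) ^ (κ * (Module.finrank ℤ (anemicHeckeRing N 2 ⧸ eigenIdeal f) : ℝ))

/-- **Rational new-part friability** (the card's E-free transfer target `C⁺₁`): the rank-one slice of
`GradedNewPartFriability` — congruence primes between a RATIONAL newform of squarefree level `N` and
any other newform orbit of level `N` are `≤ C · N^κ`.  Formally stronger than the socket only by
"every rational newform" in place of "the newform of a semistable curve" (Eichler–Shimura
construction + Faltings, not in the tree). -/
def RationalNewPartFriability : Prop :=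
  ∃ κ C : ℝ, ∀ (N : ℕ) [NeZero N], Squarefree N →
    ∀ (f g : CuspForm (Gamma0 N) 2), IsNewform0 f → IsNewform0 g → HasIntegralEigenvalues f →
      eigenIdeal f ≠ eigenIdeal g →
      ∀ ℓ : ℕ, ℓ.Prime → heckeCongruenceModulus f (eigenIdeal g) ≠ 0 →
        ℓ ∣ heckeCongruenceModulus f (eigenIdeal g) → (ℓ : ℝ) ≤ C * (N : ℝ) ^ κ

/-- **New-partner congruence primes of the datum of a semistable curve are small** (the SOCKET of
the frame = hypothesis `h7` of `degreePrimesPolyBounded_of_newPartPrimesOfDatum`; v2's bet). -/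
def NewPartPrimesOfDatum : Prop :=
  ∃ κ C : ℝ, ∀ (N : ℕ) [NeZero N] (W : WeierstrassCurve ℚ) [W.IsElliptic] [W.IsGloballyMinimal],
    W.IsSemistable ℤ → W.conductorNorm ℤ = N →
    ∀ (D : ModularParametrizationData W N) (g : CuspForm (Gamma0 N) 2), IsNewform0 g →
      eigenIdeal g ≠ eigenIdeal D.f →
      ∀ ℓ : ℕ, ℓ.Prime → ℓ ∣ heckeCongruenceModulus D.f (eigenIdeal g) →
        (ℓ : ℝ) ≤ C * (N : ℝ) ^ κ

/-- **(DR) Hecke-order discriminant roundness** — the E-free statement strictly inside the socket that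
the landed transfer (p141809 Plücker divisibility, p142474/p143335 discriminant and Gram forms) turns into
the bet (typed here for the record; NOT a registered stub; its truth is what the lead's census measures).
For a new Galois orbit `P = 𝕀_g` of squarefree level `N`, every `ℤ`-basis `b` of `𝕋/P` (rank `d`) and
every enumeration `ρ` of the `d` complex points of the orbit, there are `d` Hecke elements `y_i`,
independent modulo `P`, whose Gram–Hadamard product (with the sup of `|ρ'(y_i)|` over ALL complex points
`ρ'` of `Spec 𝕋` standing in for the unknown `χ_f`-row) is within `N^{2κ₀}` of `|disc_ℤ(b)|`.  With one
more operator `T_m`, `m ≤ μ(N rad N)/6` prime to `N`, on which the curve's `χ_f` breaks the orbit's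
relations (two-orbit Sturm on sieved forms), `exists_heckeCongruenceModulus_sq_mul_discr_le_gram` gives
`η_f(P)² ≤ N^{2κ₀} · ((d+1) · 4m + 4m)`, i.e. `RationalNewPartFriability` with `κ = κ₀ + 3/2`.
Calibration: `log Θ(P) := ½ ∑_j log Tr(T_{n_j}²) − ½ log|disc 𝕋/P|` over the pivot operators is an
upper bound for the best `½ log(∏ …/|disc|)` here; (DR) ⟸ `log Θ(P) ≤ κ₀ log N` (census column `kap`). -/
def HeckeDiscriminantRoundness : Prop :=
  ∃ κ₀ : ℝ, ∀ (N : ℕ) [NeZero N], Squarefree N →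
    ∀ (g : CuspForm (Gamma0 N) 2), IsNewform0 g →
    ∀ (d : ℕ) (b : Module.Basis (Fin d) ℤ (anemicHeckeRing N 2 ⧸ eigenIdeal g))
      (ρ : Fin d → (anemicHeckeRing N 2 ⧸ eigenIdeal g →+* ℂ)), Function.Injective ρ →
    ∃ (y : Fin d → anemicHeckeRing N 2) (H : Fin d → ℝ),
      LinearIndependent ℤ (fun i ↦ Ideal.Quotient.mk (eigenIdeal g) (y i)) ∧
      (∀ i, ∀ ρ' : anemicHeckeRing N 2 →+* ℂ, ‖ρ' (y i)‖ ≤ H i) ∧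
      ∏ i, (∑ r, ‖ρ r (Ideal.Quotient.mk (eigenIdeal g) (y i))‖ ^ 2 + H i ^ 2) ≤
        (N : ℝ) ^ (2 * κ₀) * |(Algebra.discr ℤ b : ℝ)|

/-! ## Stubs (registered) -/

/-- STUB (KNOWN, XL formal debt) — route item `ModularDatumExists` (stmt-ABC-15126), definitionally
the Literature fact `nonempty_modularParametrizationData`: every elliptic `W/ℚ` on a globally minimal
model carries a `ModularParametrizationData W N_W`.  Wiles 1995 + Taylor–Wiles 1995 (semistable, all
this line needs; landed slice form `stub_discValuationOfSemistableModularity`, p96773) / BCDT 2001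
Thm A; Carayol (level = conductor); Edixhoven 1991 (`c ∈ ℤ`). -/
theorem stub_modularity : ModularDatumExists := by
  sorry

/-- STUB (KNOWN, XL formal debt; = route item `MazurKenkuBound`, stmt-ABC-15125, `Iff.rfl`) — the
Literature fact `PastenShimura2024_minimalDegree_le_163_mul`: the minimal parametrisation degree of a
globally minimal curve of the class is `≤ 163 ·` the optimal degree (Mazur 1978 Thm 1 + Kenku 1982;
Pasten 2024 §3).  `IsGloballyMinimal` is load-bearing exactly here (Disproof near-miss
`degreePrimesPolyBounded_false_without_minimal`).  Landed reshape: semistable product form from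
`mazurKenku_exists_cyclic_isogeny` + Edixhoven Prop 2 (p99803). -/
theorem stub_mazurKenku : PastenShimura2024_minimalDegree_le_163_mul := by
  sorry

/-- STUB (KNOWN; LANDED modulo two named Galois facts as `stub_oldLevelCongruence_of_galoisFacts`,
p102794: `hMazur` = Mazur 1978 Thm 4, semistable `ℓ ≥ 11` irreducibility; `hDS` = Deligne–Serre /
Eichler–Shimura mod-`λ` representation of a weight-2 `Γ₀(M)`-newform) — the Galois input of the
old-partner peeling: if the newform `f` of a semistable globally minimal `W` of conductor `N` and the
level-`N` lift of a newform `g` of level `M ∣ N` lie under a common maximal ideal `𝔪 ∋ ℓ` of `𝕋_N`,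
`ℓ ≥ 11`, `ℓ ∤ N`, `p ∣ N`, `p ∤ M`, then `ℓ ∣ v_p(Δ_min(W))` (Ribet 1990 §§1–2; DDT 1995 Prop
2.12(c)). -/
theorem stub_oldLevelCongruence :
    ∀ (N : ℕ) [NeZero N] (W : WeierstrassCurve ℚ) [W.IsElliptic] [W.IsGloballyMinimal],
    W.IsSemistable ℤ → W.conductorNorm ℤ = N →
    ∀ (f : CuspForm (Gamma0 N) 2), IsNewformOf W f →
    ∀ (M : ℕ) [NeZero M] (hM : M ∣ N) (g : CuspForm (Gamma0 M) 2), IsNewform0 g →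
    ∀ (p ℓ : ℕ), p.Prime → ℓ.Prime → p ∣ N → ¬ p ∣ M → ¬ ℓ ∣ N → 11 ≤ ℓ →
    ∀ 𝔪 : Ideal (anemicHeckeRing N 2), 𝔪.IsMaximal → (ℓ : anemicHeckeRing N 2) ∈ 𝔪 →
      eigenIdeal f ≤ 𝔪 → eigenIdeal (toLevel0 hM 2 g) ≤ 𝔪 →
      ℓ ∣ (W.minimalDiscriminantNorm ℤ).factorization p := by
  sorry

/-- STUB — **THE BET of v2 = the socket** `NewPartPrimesOfDatum` spelled out: for a semistable
globally minimal `W/ℚ` of conductor `N`, a parametrisation datum `D` of `W` at level `N` and a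
newform `g` of level `N` in another Hecke orbit, every prime `ℓ ∣ η(D.f,[g]) = #𝕋_N/(𝕀_{D.f} + 𝕀_g)`
is `≤ C · N^κ`.  OPEN, and EQUIVALENT to crux A modulo the named facts
(`newPartPrimesOfDatum_iff_degreePrimesPolyBounded`, p106321) and to `KSameLevel` (same-level piece
of crux K).  Known: `ℓ ≤ N^{3 · rank(𝕋/𝕀_g)}` (`newPartPrime_le_rpow_finrank_partner`) — the
partner's orbit dimension in the exponent is exactly what is open. -/
theorem stub_newPartPrimesOfDatum :
    ∃ κ C : ℝ, ∀ (N : ℕ) [NeZero N] (W : WeierstrassCurve ℚ) [W.IsElliptic] [W.IsGloballyMinimal],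
      W.IsSemistable ℤ → W.conductorNorm ℤ = N →
      ∀ (D : ModularParametrizationData W N) (g : CuspForm (Gamma0 N) 2), IsNewform0 g →
        eigenIdeal g ≠ eigenIdeal D.f →
        ∀ ℓ : ℕ, ℓ.Prime → ℓ ∣ heckeCongruenceModulus D.f (eigenIdeal g) →
          (ℓ : ℝ) ≤ C * (N : ℝ) ^ κ := by
  sorry

/-! ## Proved reductions: either E-free bet reaches the socket (landed, p96184) -/

/-- The route item `MazurKenkuBound` (stmt-ABC-15125) IS the Literature fact of `stub_mazurKenku`. -/
theorem mazurKenkuBound_iff : MazurKenkuBound ↔ PastenShimura2024_minimalDegree_le_163_mul :=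
  Iff.rfl

/-- The route item `ModularDatumExists` (stmt-ABC-15126) IS the Literature fact
`nonempty_modularParametrizationData`. -/
theorem modularDatumExists_iff : ModularDatumExists ↔ nonempty_modularParametrizationData :=
  Iff.rfl

/-- **Graded ⟹ rational slice** (`rank_ℤ(𝕋/𝕀_f) = 1` for a rational newform). -/
theorem rationalNewPartFriability_of_graded' (hG : GradedNewPartFriability) :
    RationalNewPartFriability :=
  rationalNewPartFriability_of_graded hG

/-- **Rational slice ⟹ socket** (squarefree conductor of a semistable curve, `η ≠ 0` against any
other orbit). -/
theorem newPartPrimesOfDatum_of_rational (hR : RationalNewPartFriability) : NewPartPrimesOfDatum :=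
  newPartPrimesOfDatum_of_rationalNewPartFriability hR

/-- v1's registered bet implies v2's: **graded new-part friability ⟹ the socket stub's statement**
(so a proof of the E-free graded statement still closes the composition unchanged). -/
theorem stub_newPartPrimesOfDatum_of_graded (hG : GradedNewPartFriability) :
    ∃ κ C : ℝ, ∀ (N : ℕ) [NeZero N] (W : WeierstrassCurve ℚ) [W.IsElliptic] [W.IsGloballyMinimal],
      W.IsSemistable ℤ → W.conductorNorm ℤ = N →
      ∀ (D : ModularParametrizationData W N) (g : CuspForm (Gamma0 N) 2), IsNewform0 g →
        eigenIdeal g ≠ eigenIdeal D.f →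
        ∀ ℓ : ℕ, ℓ.Prime → ℓ ∣ heckeCongruenceModulus D.f (eigenIdeal g) →
          (ℓ : ℝ) ≤ C * (N : ℝ) ^ κ :=
  newPartPrimesOfDatum_of_rational (rationalNewPartFriability_of_graded' hG)

/-- **The socket from the same-level piece of crux K** (unconditional, landed p106321). -/
theorem stub_newPartPrimesOfDatum_of_kSameLevel' (hK : KSameLevel) : NewPartPrimesOfDatum :=
  newPartPrimesOfDatum_of_kSameLevel hK

/-! ## Composition -/

/-- **Crux A from the stubs** — the skeleton's composition: the LANDED frame
`degreePrimesPolyBounded_of_newPartPrimesOfDatum` (p96184; real proof, standard axioms) applied BY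
NAME to the registered stubs `stub_modularity`, `stub_mazurKenku`, `stub_oldLevelCongruence`,
`stub_newPartPrimesOfDatum` and to the landed theorems `stub_spectral` (Pasten Thm 5.5, p86085),
`stub_minimalPrimes` (Atkin–Lehner–Li, p86417), `stub_oldPartner_of` (peeling, p88376),
`discValuation_of_modularity_of_mazurKenku` (`v_p(Δ_min) ≤ C N²`).  The only `sorry`s in its cone are
the four stubs. -/
theorem DegreePrimesPolyBounded_of :
    Summit.ABC.ABC.Theses.IsogenyGlueCongruence.DegreePrimesPolyBounded :=
  degreePrimesPolyBounded_of_newPartPrimesOfDatum (fun W _ _ _ _ ↦ stub_modularity W) stub_mazurKenku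
    stub_spectral stub_minimalPrimes (stub_oldPartner_of stub_oldLevelCongruence)
    (discValuation_of_modularity_of_mazurKenku stub_modularity stub_mazurKenku)
    stub_newPartPrimesOfDatum

/-! ## What the stubs are worth (theorems about the line, landed) -/

/-- **The bet is equivalent to the crux** modulo the three known stubs and the printed same-level
inputs `SameLevelCongruenceFacts` of the K-line (p106321): nothing registered here is smaller than A. -/
theorem stub_newPartPrimesOfDatum_iff_crux (hF : SameLevelCongruenceFacts) :
    NewPartPrimesOfDatum ↔ Summit.ABC.ABC.Theses.IsogenyGlueCongruence.DegreePrimesPolyBounded :=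
  newPartPrimesOfDatum_iff_degreePrimesPolyBounded stub_modularity stub_mazurKenku
    stub_oldLevelCongruence hF

/-- **The old-level stub from its two named Galois facts** (landed p102794): Mazur 1978 Thm 4 and the
mod-`λ` representation of a weight-2 newform give `stub_oldLevelCongruence`'s statement. -/
theorem stub_oldLevelCongruence_of_galoisFacts'
    (hMazur : ∀ (W : WeierstrassCurve ℚ) [W.IsElliptic], W.IsSemistable ℤ →
      ∀ ℓ : ℕ, ℓ.Prime → 11 ≤ ℓ → W.HasIrreducibleModPGaloisRep ℓ)
    (hDS : ∀ (M : ℕ) [NeZero M] (g : CuspForm (Gamma0 M) 2), IsNewform0 g →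
      ∀ (ℓ : ℕ) [Fact ℓ.Prime] (S : Finset ℕ), (∀ q : ℕ, q.Prime → q ∣ M * ℓ → q ∈ S) →
      ∀ (R : Subring ℂ)
        (hR : ∀ q : ℕ, q.Prime → q ∉ S → (UpperHalfPlane.qExpansion 1 ⇑g).coeff q ∈ R)
        (k : Type) [Field k] [CharP k ℓ] [TopologicalSpace k] [DiscreteTopology k]
        (ψ : R →+* k),
      ∃ ρ : Literature.NumberTheory.GaloisRepresentations.FramedGaloisRep ℚ k 2,
        ρ.toGaloisRep.IsSemisimple ∧
        (∀ v : IsDedekindDomain.HeightOneSpectrum (NumberField.RingOfIntegers ℚ),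
          ¬ ((Rat.HeightOneSpectrum.primesEquiv v : Nat.Primes) : ℕ) ∣ M * ℓ → ρ.IsUnramifiedAt v) ∧
        ∀ (v : IsDedekindDomain.HeightOneSpectrum (NumberField.RingOfIntegers ℚ))
          (hv : ((Rat.HeightOneSpectrum.primesEquiv v : Nat.Primes) : ℕ) ∉ S),
          ρ.HasFrobCharpolyAt v (Polynomial.X ^ 2 - Polynomial.C (ψ
            ⟨(UpperHalfPlane.qExpansion 1 ⇑g).coeff ((Rat.HeightOneSpectrum.primesEquiv v : Nat.Primes) : ℕ),
              hR _ (Rat.HeightOneSpectrum.primesEquiv v).2 hv⟩) * Polynomial.X +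
            Polynomial.C ((((Rat.HeightOneSpectrum.primesEquiv v : Nat.Primes) : ℕ) : k)))) :
    ∀ (N : ℕ) [NeZero N] (W : WeierstrassCurve ℚ) [W.IsElliptic] [W.IsGloballyMinimal],
    W.IsSemistable ℤ → W.conductorNorm ℤ = N →
    ∀ (f : CuspForm (Gamma0 N) 2), IsNewformOf W f →
    ∀ (M : ℕ) [NeZero M] (hM : M ∣ N) (g : CuspForm (Gamma0 M) 2), IsNewform0 g →
    ∀ (p ℓ : ℕ), p.Prime → ℓ.Prime → p ∣ N → ¬ p ∣ M → ¬ ℓ ∣ N → 11 ≤ ℓ →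
    ∀ 𝔪 : Ideal (anemicHeckeRing N 2), 𝔪.IsMaximal → (ℓ : anemicHeckeRing N 2) ∈ 𝔪 →
      eigenIdeal f ≤ 𝔪 → eigenIdeal (toLevel0 hM 2 g) ≤ 𝔪 →
      ℓ ∣ (W.minimalDiscriminantNorm ℤ).factorization p :=
  stub_oldLevelCongruence_of_galoisFacts hMazur hDS

/-- **Calibration of the bet (the known regime, partner's dimension in the exponent)**: a new
congruence prime of a curve datum at level `N ≥ 11` is `≤ N^{3 · rank_ℤ(𝕋/𝕀_g)}` (landed). -/
theorem newPartPrime_le_rpow_finrank_partner' {N : ℕ} [NeZero N] (hN : 11 ≤ N)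
    {W : WeierstrassCurve ℚ} [W.IsElliptic] (D : ModularParametrizationData W N)
    {g : CuspForm (Gamma0 N) 2} (hg : IsNewform0 g) (hne : eigenIdeal g ≠ eigenIdeal D.f)
    {ℓ : ℕ} (hdvd : ℓ ∣ heckeCongruenceModulus D.f (eigenIdeal g)) :
    (ℓ : ℝ) ≤ (N : ℝ) ^ (3 * (Module.finrank ℤ (anemicHeckeRing N 2 ⧸ eigenIdeal g) : ℝ)) :=
  newPartPrime_le_rpow_finrank_partner hN D hg hne hdvd

/-! ## The other socket user: the sibling engine plugs into the same frame -/

/-- Crux A through the SEPARATOR bet of line `Sketch` on the same three known stubs (real proof; the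
landed `newPartPrimes_of_smallHeckeSeparators`, p89252, has the socket as its literal conclusion). -/
theorem degreePrimesPolyBounded_of_smallHeckeSeparators
    (hsep : ∃ A C : ℝ, ∀ (N : ℕ) [NeZero N] (f g : CuspForm (Gamma0 N) 2), IsNewform0 f →
      IsNewform0 g → HasIntegralEigenvalues f → eigenIdeal f ≠ eigenIdeal g →
      ∃ (S : Finset ℕ) (u : ℕ → ℤ) (hS : ∀ p ∈ S, p.Prime ∧ ¬ p ∣ N),
        (∀ p ∈ S, (p : ℝ) ≤ C * (N : ℝ) ^ A) ∧ (∀ p ∈ S, |(u p : ℝ)| ≤ C * (N : ℝ) ^ A) ∧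
        (∑ p ∈ S.attach, u p •
            @anemicHeckeRing.T N _ 2 (p : ℕ) ⟨(hS p p.2).1.ne_zero⟩ (hS p p.2).1 (hS p p.2).2) ∈
          eigenIdeal g ∧
        (∑ p ∈ S.attach, u p •
            @anemicHeckeRing.T N _ 2 (p : ℕ) ⟨(hS p p.2).1.ne_zero⟩ (hS p p.2).1 (hS p p.2).2) ∉
          eigenIdeal f) :
    Summit.ABC.ABC.Theses.IsogenyGlueCongruence.DegreePrimesPolyBounded :=
  degreePrimesPolyBounded_of_newPartPrimesOfDatum (fun W _ _ _ _ ↦ stub_modularity W) stub_mazurKenku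
    stub_spectral stub_minimalPrimes (stub_oldPartner_of stub_oldLevelCongruence)
    (discValuation_of_modularity_of_mazurKenku stub_modularity stub_mazurKenku)
    (newPartPrimes_of_smallHeckeSeparators hsep)

end Summit.ABC.ABC.Cruxes.DegreePrimesPolyBounded.NewpartCongruenceFriability

end
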